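import Literature.AnabelianGeometry.EtaleTheta.TemperedFrobenioidGenuineWeakPiNatR
import Literature.AnabelianGeometry.EtaleTheta.Discharge.Sec3Cor38iiiOfRlfRWeak
import Literature.AnabelianGeometry.EtaleTheta.Discharge.Sec3Cor38iiiWeakPiNatInstance
import HarnessLib

/-!
# [EtTh] Cor. 3.8 (iii), first clause, monoid type `Λ = ℝ`, at INFINITELY many special-fibre components: the
# weak-vocabulary `ℝ`-apex FIRES with no binder at `WeakPiNat.genuineTemperedFrobenioidR` (closed instance)

Mochizuki, *The étale theta function …*, Publ. RIMS **45** (2009), Cor. 3.8 (iii) p.81, Def. 3.6 (ii) p.77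
[cite: MochizukiEtTh2009, Cor 3.8 p.81]; Mochizuki, *The geometry of Frobenioids I* (2008), Thm. 5.2 (ii) p.100
[cite: MochizukiFrdI2008, Thm. 5.2(ii) p.100].

abc-iut cell, layer L2, seat abc-iut-L2-d2 (gen 4), row «NV-L2/TemperedFrobenioid-WEAK-∞» + (H)-ℝ (abc-iut-L2-lead
gen 4 R227/R300); proof-only `Λ = ℝ` companion of `Sec3Cor38iiiWeakPiNatInstance.lean`.  For
`C := WeakPiNat.genuineTemperedFrobenioidR R S` (Def. 3.6 (ii) of monoid type `ℝ` over `treeMonoidVocabWeak` at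
`Φ₀ = ∏_ℕ ℤ_{≥0}`) the three residual inputs of this seat's `ℝ`-apex
`cor38_iii_ofRlfRWeak_of_isFrobenioid_of_countable_of_prop34Const` (`Discharge/Sec3Cor38iiiOfRlfRWeak.lean`) are
theorems: `isFrobenioid_genuineTemperedFrobenioidR` ([FrdI] Thm. 5.2 (ii)), the countability of the primes of
`Φ(A)^pf` and `Prop34Const` (both SHARED with the `Λ = ℤ` witness: same `Φ`, same Def. 3.3 (iii) datum); and
`nonempty_cor38HypR`.  Hence **`cor38_iii_genuineTemperedFrobenioidR : ∀ h : Cor38Hyp C C', Cor38_iii h`**.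

HONEST LABEL: degenerate GENUINE-vocabulary instance; a consistency / instantiation certificate for OUR typing;
nothing here bears on [IUTchIII] Cor. 3.12.  No definitions.
-/

noncomputable section

namespace Literature.AnabelianGeometry.EtaleTheta

open CategoryTheory Opposite Literature.AlgebraicGeometry.Frobenioids

namespace WeakPiNat

variable (R S : ((Discrete PUnit.{1})ᵒᵖ ⥤ CommMonCat.{0}) → Prop)

/-- **The `Λ = ℝ` weak-vocabulary witness is a Frobenioid** ([FrdI] Thm. 5.2 (ii), `ModelFrobenioid.isFrobenioid`:
`Φ`, `B = B₀^ℝ|_D ×_{(Φ^{ℝ-log})^gp} Φ^gp` monoids on the one-object base, `Φ` divisorial, `B` group-like, `D`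
connected and totally epimorphic). [cite: MochizukiFrdI2008, Thm. 5.2(ii) p.100] -/
theorem isFrobenioid_genuineTemperedFrobenioidR :
    PreFrobenioid.IsFrobenioid (genuineTemperedFrobenioidR R S).toElem :=
  ModelFrobenioid.isFrobenioid
    (Cor38Toy.isMonoidOn_of_punit _)
    (fun A => PfImageWeak.isDivisorial_mrange_toRealification (isPerfFactorialCof_Φ₀ (op A)))
    (Cor38Toy.isMonoidOn_of_punit _)
    ((genuineTemperedFrobenioidR R S).isGroupLike_ratFnFunctor realifiedR.isUnit_BΛ)
    (isGraphConnected_iff_isConnected.mpr (genuineTemperedFrobenioidR R S).isConnected)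
    (genuineTemperedFrobenioidR R S).isTotallyEpimorphic

/-- The primes of `Φ(A)^pf` are countable (same `Φ = ι(Φ₀^pf)` as at `Λ = ℤ`).
[cite: MochizukiEtTh2009, Prop 3.2 p.70] -/
theorem countable_primes_perfection_ΦR (A : (Discrete PUnit.{1})ᵒᵖ) :
    Countable (Primes (Perfection ↥((genuineTemperedFrobenioidR R S).Φ.carrier A))) :=
  countable_primes_perfection_Φ R S A

/-- `Φ` of the `ℝ`-witness is non-dilating under the endomorphisms of the base (identities).
[cite: MochizukiEtTh2009, Cor 3.8 p.80] -/
theorem genuineTemperedFrobenioidR_nonDilating (A : (Discrete PUnit.{1})ᵒᵖ) (f : A ⟶ A) :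
    treeMonoidVocabWeak.IsNonDilating _ ((genuineTemperedFrobenioidR R S).Φ.pull f) := by
  have hf : f = 𝟙 A := Quiver.Hom.unop_inj (Subsingleton.elim _ _)
  subst hf
  rw [treeMonoidVocabWeak_isNonDilating]
  have hpull : (genuineTemperedFrobenioidR R S).Φ.pull (𝟙 A) = MonoidHom.id _ := by
    ext x
    rw [SubMonoidOn.coe_pull, CategoryTheory.Functor.map_id, MonoidHom.id_apply]
    rfl
  rw [hpull]
  exact Example39NV.isNonDilating_id

/-- **`Cor38Hyp` is inhabited at the `ℝ`-witness** (`Ψ := 𝟭`; `D` of FSM- hence FSMFF-type; `Φ` non-dilating).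
[cite: MochizukiEtTh2009, Cor 3.8 p.80] -/
theorem nonempty_cor38HypR :
    Nonempty (Cor38Hyp (genuineTemperedFrobenioidR R S) (genuineTemperedFrobenioidR R S)) :=
  ⟨{ Ψ := CategoryTheory.Equivalence.refl
     fsmff := ⟨PadicFrd.isOfFSMType_discretePUnit.isOfFSMFFType, PadicFrd.isOfFSMType_discretePUnit.isOfFSMFFType⟩
     nonDilating := ⟨genuineTemperedFrobenioidR_nonDilating R S, genuineTemperedFrobenioidR_nonDilating R S⟩ }⟩

variable (R' S' : ((Discrete PUnit.{1})ᵒᵖ ⥤ CommMonCat.{0}) → Prop)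

/-- **[EtTh] Cor. 3.8 (iii), first clause, AS TYPED, monoid type `Λ = ℝ`, with NO hypothesis for EVERY Cor. 3.8 datum
between two weak-vocabulary `ℝ`-witnesses at `Φ₀ = ∏_ℕ ℤ_{≥0}`** — this seat's `ℝ`-apex with `IsFrobenioid`, `hcnt`,
`Prop34Const` discharged above / in the `Λ = ℤ` instance file. [cite: MochizukiEtTh2009, Cor 3.8 p.81] -/
theorem cor38_iii_genuineTemperedFrobenioidR
    (h : Cor38Hyp (genuineTemperedFrobenioidR R S) (genuineTemperedFrobenioidR R' S')) : Cor38_iii h :=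
  cor38_iii_ofRlfRWeak_of_isFrobenioid_of_countable_of_prop34Const h
    (countable_primes_perfection_ΦR R S) (countable_primes_perfection_ΦR R' S')
    prop34Const_divisorMonoids prop34Const_divisorMonoids
    (isFrobenioid_genuineTemperedFrobenioidR R S) (isFrobenioid_genuineTemperedFrobenioidR R' S')

/-- Hence `Cor38_iii` is INHABITED by a `Λ = ℝ` Cor. 3.8 datum over the weak vocabulary at infinitely many
special-fibre components. [cite: MochizukiEtTh2009, Cor 3.8 p.81] -/
theorem exists_cor38Hyp_cor38_iii_R :
    ∃ h : Cor38Hyp (genuineTemperedFrobenioidR R S) (genuineTemperedFrobenioidR R S), Cor38_iii h :=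
  (nonempty_cor38HypR R S).elim fun h => ⟨h, cor38_iii_genuineTemperedFrobenioidR R S R S h⟩

end WeakPiNat

end Literature.AnabelianGeometry.EtaleTheta

end
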